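import Summits.NavierStokesRegularity.NavierStokesRegularity.Theorems.IntenseSetDoorsDefs
import Summits.NavierStokesRegularity.NavierStokesRegularity.Theorems.CriticalCoherenceDoorPower
import Literature.Analysis.FluidPDE.ConstantinFeffermanEnstrophySlab
import Literature.Analysis.FluidPDE.NSVorticityBKMContinuation
import Literature.Analysis.FluidPDE.ConstantinFeffermanStretching
import Literature.Analysis.FluidPDE.TaoEnstrophyLocalisationProofs
import Literature.Analysis.FluidPDE.EnstrophyGronwall
import HarnessLib

/-!
# S34 «IntenseSetDoors» — shared tools of the assemblies A34-A / A34-B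

Summits-side proof file (theorems only) for door family S34 (nsreg-p1 g28, ROUND-32; texts of record
`r32/Sketch34.lean` c542dddc314f2f7c = tree P0 `Theorems/IntenseSetDoorsDefs.lean`). The glue of
PLATE-AID-34 §A34 that doors A and B share, isolated so that both assembly files stay short:

* `exponentB` — the exponent algebra of door B: with `η := (√3/(4ε₀) − 1)/2`, `a₁ := (2/√3)(1+η)ε₀`,
  `a := max a₁ ((2c − 1)/4)`: `0 ≤ a₁ ≤ a < 1/2` and `c < a + 1` (for `ε₀ < √3/4`, `c < 3/2`);
* `slice_package` — at every time of a closed slab `[0, T'']` the velocity slice of a classical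
  solution with bounded Sobolev norms is an admissible field of the fixed-time plates (`C³`,
  divergence free, `v, ∇v, ∇²v ∈ L²`, `∇²v` and `∇v` bounded, uniformly on the slab);
* `two_mul_integral_stretching_le_lamb` — V34 + L34 at a level `L`: the full stretching splits as
  LOW + HIGH, `2∫⟪ω,(∇v)ω⟫ ≤ (2/√3)(1+η)L ∫|ω|² + C ‖∇ω‖_{L²_F} ‖v × ω‖_{L²({|ω| > L})}`
  (`∫|∇v|²_F ≤ ∫|ω|²`, `lintegral_frobeniusNormSq_fderiv_le_lintegral_sq_norm_curl`);
* `setIntegral_norm_sq_le_of_lintegral_le` — the door hypotheses (stated with `∫⁻`) bound the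
  Bochner set integrals the plates use;
* `lintegral_frobeniusNormSq_le_of_integral_curl_sq_le` — the output conversion
  `∫|ω(t)|² ≤ R ⇒ ∫⁻|∇u(t)|²_F ≤ ofReal R`.

HONEST FRAME: bookkeeping only; S34 = three regularity CRITERIA; item 0056 `NoTypeII` / NS regularity
NOT proved.
-/

noncomputable section

set_option linter.dupNamespace false

open MeasureTheory Set Function Filter Metric Real InnerProductSpace
open _root_.Topology
open scoped ENNReal NNReal RealInnerProductSpace ContDiff
open Literature.Analysis Literature.Analysis.FluidPDE
open Summit.NavierStokesRegularity.NavierStokesRegularity.Theorems.CriticalCoherenceDoor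
  (exponent_of_lt_sqrt_three_div_four)

namespace Summit.NavierStokesRegularity.NavierStokesRegularity.Theorems.IntenseSetDoors

-- nested operator types (second derivatives)
set_option maxSynthPendingDepth 3

/-- **Exponent algebra of door B.** For `0 < ε₀ < √3/4` and `c < 3/2`, with
`η := (√3/(4ε₀) − 1)/2`, `a₁ := (2/√3)(1+η)ε₀` and `a := max a₁ ((2c − 1)/4)`:
`0 < η`, `0 ≤ a₁ ≤ a`, `a < 1/2`, `c < a + 1`. [folklore] -/
theorem exponentB {ε₀ c : ℝ} (hε₀ : 0 < ε₀) (hε₁ : ε₀ < Real.sqrt 3 / 4) (hc : c < 3 / 2) :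
    0 < (Real.sqrt 3 / (4 * ε₀) - 1) / 2 ∧
    0 ≤ 2 / Real.sqrt 3 * (1 + (Real.sqrt 3 / (4 * ε₀) - 1) / 2) * ε₀ ∧
    2 / Real.sqrt 3 * (1 + (Real.sqrt 3 / (4 * ε₀) - 1) / 2) * ε₀ ≤
      max (2 / Real.sqrt 3 * (1 + (Real.sqrt 3 / (4 * ε₀) - 1) / 2) * ε₀) ((2 * c - 1) / 4) ∧
    max (2 / Real.sqrt 3 * (1 + (Real.sqrt 3 / (4 * ε₀) - 1) / 2) * ε₀) ((2 * c - 1) / 4) < 1 / 2 ∧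
    c < max (2 / Real.sqrt 3 * (1 + (Real.sqrt 3 / (4 * ε₀) - 1) / 2) * ε₀) ((2 * c - 1) / 4) + 1 := by
  obtain ⟨hη, ha0, ha⟩ := exponent_of_lt_sqrt_three_div_four hε₀ hε₁
  refine ⟨hη, ha0, le_max_left _ _, max_lt ha (by linarith), ?_⟩
  have h2 : (2 * c - 1) / 4 ≤
      max (2 / Real.sqrt 3 * (1 + (Real.sqrt 3 / (4 * ε₀) - 1) / 2) * ε₀) ((2 * c - 1) / 4) :=
    le_max_right _ _
  linarith

/-- **The slice package.** On a closed slab `[0, T'']` a classical unforced Navier–Stokes solution with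
bounded `L²` Sobolev seminorms has, at every time `s` of the slab, an admissible slice `u s`: `C³`,
divergence free, `u s, ∇(u s), ∇²(u s) ∈ L²`, with `∇(u s)` and `∇²(u s)` bounded uniformly in `s`
(Sobolev embedding `H² ⊂ L^∞` on `ℝ³`, the tree's `exists_forall_norm_fderiv(_fderiv)_le_of_…`). [folklore] -/
theorem slice_package {ν T'' : ℝ} {u : ℝ → (EuclideanSpace ℝ (Fin 3)) → (EuclideanSpace ℝ (Fin 3))}
    {p : ℝ → (EuclideanSpace ℝ (Fin 3)) → ℝ} (hS : IsClassicalNSSolutionOn (Icc 0 T'') ν 0 u p)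
    (hB : HasBoundedSobolevNormsOn (Icc 0 T'') u) :
    ∃ B₁ B₂ : ℝ, 0 ≤ B₁ ∧ 0 ≤ B₂ ∧ ∀ s ∈ Icc 0 T'',
      ContDiff ℝ 3 (u s) ∧ VectorCalculus.IsDivFree (u s) ∧
      (Integrable fun x => ‖u s x‖ ^ 2) ∧ (Integrable fun x => ‖fderiv ℝ (u s) x‖ ^ 2) ∧
      (Integrable fun x => ‖fderiv ℝ (fderiv ℝ (u s)) x‖ ^ 2) ∧
      (∀ x, ‖fderiv ℝ (u s) x‖ ≤ B₁) ∧ (∀ x, ‖fderiv ℝ (fderiv ℝ (u s)) x‖ ≤ B₂) := by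
  obtain ⟨B₁, hB₁0, hB₁⟩ := exists_forall_norm_fderiv_le_of_hasBoundedSobolevNormsOn
    (fun r hr => (hS.contDiff_velocity hr).of_le (by norm_cast)) hB
  obtain ⟨B₂, hB₂0, hB₂⟩ := exists_forall_norm_fderiv_fderiv_le_of_hasBoundedSobolevNormsOn
    (fun r hr => (hS.contDiff_velocity hr).of_le (by norm_cast)) hB
  refine ⟨B₁, B₂, hB₁0, hB₂0, fun s hs => ?_⟩
  have hv : ContDiff ℝ ∞ (u s) := hS.contDiff_velocity hs
  have hv4 : ContDiff ℝ 4 (u s) := hv.of_le (by norm_cast)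
  have hfin : ∀ n, ∫⁻ x, ‖iteratedFDeriv ℝ n (u s) x‖ₑ ^ 2 < ⊤ := fun n => by
    obtain ⟨Cn, hCn⟩ := hB n
    exact (hCn s hs).trans_lt ENNReal.coe_lt_top
  have i0 : Integrable fun x => ‖u s x‖ ^ 2 := by
    have h := integrable_sq_norm_of_lintegral_lt_top (hv4.continuous_iteratedFDeriv (by norm_num)) (hfin 0)
    exact h.congr (Eventually.of_forall fun x => by simp only [norm_iteratedFDeriv_zero])
  have i1 : Integrable fun x => ‖fderiv ℝ (u s) x‖ ^ 2 := by
    have h := integrable_sq_norm_of_lintegral_lt_top (hv4.continuous_iteratedFDeriv (by norm_num)) (hfin 1)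
    exact h.congr (Eventually.of_forall fun x => by simp only [norm_iteratedFDeriv_one])
  have i2 : Integrable fun x => ‖fderiv ℝ (fderiv ℝ (u s)) x‖ ^ 2 := by
    have h := integrable_sq_norm_of_lintegral_lt_top (hv4.continuous_iteratedFDeriv (by norm_num)) (hfin 2)
    refine h.congr (Eventually.of_forall fun x => ?_)
    show ‖iteratedFDeriv ℝ 2 (u s) x‖ ^ 2 = ‖fderiv ℝ (fderiv ℝ (u s)) x‖ ^ 2
    rw [← norm_iteratedFDeriv_fderiv, norm_iteratedFDeriv_one]
  exact ⟨hv.of_le (by norm_cast), hS.divFree s hs, i0, i1, i2, hB₁ s hs, hB₂ s hs⟩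

/-- **V34 + L34 at one level (the fixed-time engine of doors A and B).** Given the low plate
`ValueCutoffLowStretching` and the constant `C` of the Lamb pairing plate at width `η > 0`, for a level
`L > 0` and an admissible field `v` with bounded gradient (`ω = curl v`):
`2∫⟪ω,(∇v)ω⟫ ≤ (2/√3)(1+η)L ∫|ω|² + C ‖∇ω‖_{L²_F} ‖v × ω‖_{L²({|ω| > L})}` — split the stretching
density with the value cut-off `θ_{L,(1+η)L}(ω)` (both pieces integrable: `|⟪ω,(∇v)ω⟫| ≤ B₁|ω|²`),
LOW by V34 and `∫|∇v|²_F ≤ ∫|ω|²` (`lintegral_frobeniusNormSq_fderiv_le_lintegral_sq_norm_curl`), HIGH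
by L34. [folklore] -/
theorem two_mul_integral_stretching_le_lamb (hV : ValueCutoffLowStretching) {η C : ℝ} (hη : 0 < η)
    (hC : ∀ (L : ℝ), 0 < L →
      ∀ ⦃v : (EuclideanSpace ℝ (Fin 3)) → (EuclideanSpace ℝ (Fin 3))⦄ (_ : ContDiff ℝ 2 v)
        (_ : VectorCalculus.IsDivFree v)
        (_ : Integrable fun x => ‖v x‖ ^ 2) (_ : Integrable fun x => ‖fderiv ℝ v x‖ ^ 2)
        (_ : Integrable fun x => ‖fderiv ℝ (fderiv ℝ v) x‖ ^ 2)
        (_ : ∃ B : ℝ, ∀ x, ‖fderiv ℝ (fderiv ℝ v) x‖ ≤ B),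
        2 * ∫ x, (1 - radialCutoff L ((1 + η) * L) (curl v x)) *
            ⟪curl v x, fderiv ℝ v x (curl v x)⟫ ≤
          C * Real.sqrt (∫ x, frobeniusNormSq (fderiv ℝ (curl v) x)) *
            Real.sqrt (∫ x in {x | L < ‖curl v x‖}, ‖cross (v x) (curl v x)‖ ^ 2))
    {L : ℝ} (hL : 0 < L) {v : (EuclideanSpace ℝ (Fin 3)) → (EuclideanSpace ℝ (Fin 3))}
    (hv : ContDiff ℝ 2 v) (hdiv : VectorCalculus.IsDivFree v) (hE : Integrable fun x => ‖v x‖ ^ 2)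
    (hG : Integrable fun x => ‖fderiv ℝ v x‖ ^ 2)
    (hH : Integrable fun x => ‖fderiv ℝ (fderiv ℝ v) x‖ ^ 2) {B : ℝ}
    (hB : ∀ x, ‖fderiv ℝ (fderiv ℝ v) x‖ ≤ B) {B₁ : ℝ} (hB₁ : ∀ x, ‖fderiv ℝ v x‖ ≤ B₁) :
    2 * ∫ x, ⟪curl v x, fderiv ℝ v x (curl v x)⟫ ≤
      2 / Real.sqrt 3 * ((1 + η) * L) * (∫ x, ‖curl v x‖ ^ 2) +
        C * Real.sqrt (∫ x, frobeniusNormSq (fderiv ℝ (curl v) x)) *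
          Real.sqrt (∫ x in {x | L < ‖curl v x‖}, ‖cross (v x) (curl v x)‖ ^ 2) := by
  have hLb : L < (1 + η) * L := by nlinarith
  have hb0 : 0 < (1 + η) * L := hL.trans hLb
  have hω1 : ContDiff ℝ 1 (curl v) := contDiff_curl (n := 1) (by exact hv)
  have hωc : Continuous (curl v) := hω1.continuous
  have hDv : Continuous (fderiv ℝ v) := hv.continuous_fderiv (by norm_num)
  -- integrability of the stretching density and of its two pieces
  have Iω : Integrable fun x => ‖curl v x‖ ^ 2 := by
    refine (hG.const_mul (‖curlCLM‖ ^ 2)).mono' ((hωc.norm.pow 2).aestronglyMeasurable)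
      (Eventually.of_forall fun x => ?_)
    rw [Real.norm_of_nonneg (sq_nonneg _), ← mul_pow]
    exact pow_le_pow_left₀ (norm_nonneg _) (norm_curl_le v x) 2
  set g : (EuclideanSpace ℝ (Fin 3)) → ℝ := fun x => ⟪curl v x, fderiv ℝ v x (curl v x)⟫ with hg
  have hgc : Continuous g := hωc.inner (hDv.clm_apply hωc)
  have hgle : ∀ x, ‖g x‖ ≤ B₁ * ‖curl v x‖ ^ 2 := fun x =>
    calc ‖g x‖ ≤ ‖curl v x‖ * ‖fderiv ℝ v x (curl v x)‖ := norm_inner_le_norm _ _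
      _ ≤ ‖curl v x‖ * (B₁ * ‖curl v x‖) := by
          refine mul_le_mul_of_nonneg_left ?_ (norm_nonneg _)
          exact (ContinuousLinearMap.le_opNorm _ _).trans (mul_le_mul_of_nonneg_right (hB₁ x) (norm_nonneg _))
      _ = B₁ * ‖curl v x‖ ^ 2 := by ring
  have Ig : Integrable g := (Iω.const_mul B₁).mono' hgc.aestronglyMeasurable (Eventually.of_forall hgle)
  set θ : (EuclideanSpace ℝ (Fin 3)) → ℝ := fun x => radialCutoff L ((1 + η) * L) (curl v x) with hθ
  have hθc : Continuous θ :=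
    (radialCutoff_contDiff (E' := EuclideanSpace ℝ (Fin 3)) L ((1 + η) * L) (n := 0)).continuous.comp hωc
  have hθ01 : ∀ x, 0 ≤ θ x ∧ θ x ≤ 1 := fun x => ⟨radialCutoff_nonneg _ _ _, radialCutoff_le_one _ _ _⟩
  have Ilo : Integrable fun x => θ x * g x := by
    refine Ig.norm.mono' (hθc.mul hgc).aestronglyMeasurable (Eventually.of_forall fun x => ?_)
    rw [norm_mul, Real.norm_of_nonneg (hθ01 x).1]
    exact mul_le_of_le_one_left (norm_nonneg _) (hθ01 x).2
  have Ihi : Integrable fun x => (1 - θ x) * g x := by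
    refine Ig.norm.mono' ((continuous_const.sub hθc).mul hgc).aestronglyMeasurable
      (Eventually.of_forall fun x => ?_)
    rw [norm_mul, Real.norm_of_nonneg (sub_nonneg.2 (hθ01 x).2)]
    exact mul_le_of_le_one_left (norm_nonneg _) (sub_le_self _ (hθ01 x).1)
  have hsplit : ∫ x, g x = (∫ x, θ x * g x) + ∫ x, (1 - θ x) * g x := by
    rw [← integral_add Ilo Ihi]
    exact integral_congr_ae (Eventually.of_forall fun x => by simp only; ring)
  -- LOW: V34 and `∫|∇v|²_F ≤ ∫|ω|²`
  have hlo := hV L ((1 + η) * L) hL hLb hv hdiv hE hG hH ⟨B, hB⟩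
  have Ifv : Integrable fun x => frobeniusNormSq (fderiv ℝ v x) := by
    refine (hG.const_mul 3).mono' (continuous_frobeniusNormSq_fderiv hv (by norm_num)).aestronglyMeasurable
      (Eventually.of_forall fun x => ?_)
    rw [Real.norm_of_nonneg (frobeniusNormSq_nonneg _)]
    exact frobeniusNormSq_le_three_mul _
  have hY0 : 0 ≤ ∫ x, ‖curl v x‖ ^ 2 := integral_nonneg fun x => sq_nonneg _
  have hFY : ∫ x, frobeniusNormSq (fderiv ℝ v x) ≤ ∫ x, ‖curl v x‖ ^ 2 := by
    have h := lintegral_frobeniusNormSq_fderiv_le_lintegral_sq_norm_curl hv hdiv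
      (lintegral_enorm_sq_lt_top_of_integrable_sq hE)
    have hFl : ENNReal.ofReal (∫ x, frobeniusNormSq (fderiv ℝ v x)) =
        ∫⁻ x, ENNReal.ofReal (frobeniusNormSq (fderiv ℝ v x)) :=
      ofReal_integral_eq_lintegral_ofReal Ifv (Eventually.of_forall fun x => frobeniusNormSq_nonneg _)
    have hYl : ∫⁻ x, ‖curl v x‖ₑ ^ 2 = ENNReal.ofReal (∫ x, ‖curl v x‖ ^ 2) := by
      rw [ofReal_integral_eq_lintegral_ofReal Iω (Eventually.of_forall fun x => sq_nonneg _)]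
      refine lintegral_congr fun x => ?_
      rw [ENNReal.ofReal_pow (norm_nonneg _), ofReal_norm]
    rw [← hFl, hYl] at h
    exact (ENNReal.ofReal_le_ofReal_iff hY0).1 h
  -- HIGH: L34
  have hhi := hC L hL hv hdiv hE hG hH ⟨B, hB⟩
  have hlo' : 2 * ∫ x, θ x * g x ≤ 2 / Real.sqrt 3 * ((1 + η) * L) * ∫ x, ‖curl v x‖ ^ 2 :=
    hlo.trans (mul_le_mul_of_nonneg_left hFY (by positivity))
  calc 2 * ∫ x, ⟪curl v x, fderiv ℝ v x (curl v x)⟫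
      = 2 * (∫ x, θ x * g x) + 2 * ∫ x, (1 - θ x) * g x := by rw [← hg, hsplit]; ring
    _ ≤ _ := add_le_add hlo' hhi

/-- **Door hypotheses to Bochner set integrals**: if `∫⁻_S ‖F‖ₑ² ≤ ofReal r` and `r ≤ R`, `0 ≤ R`,
then `∫_S ‖F‖² ≤ R` (for a continuous field `F`). [folklore] -/
theorem setIntegral_norm_sq_le_of_lintegral_le {S : Set (EuclideanSpace ℝ (Fin 3))}
    {F : (EuclideanSpace ℝ (Fin 3)) → (EuclideanSpace ℝ (Fin 3))} (hF : Continuous F) {r R : ℝ}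
    (h : ∫⁻ x in S, ‖F x‖ₑ ^ 2 ≤ ENNReal.ofReal r) (hrR : r ≤ R) (hR : 0 ≤ R) :
    ∫ x in S, ‖F x‖ ^ 2 ≤ R := by
  rw [integral_eq_lintegral_of_nonneg_ae (Eventually.of_forall fun x => sq_nonneg _)
    (hF.norm.pow 2).aestronglyMeasurable]
  have h' : ∫⁻ x in S, ENNReal.ofReal (‖F x‖ ^ 2) ≤ ENNReal.ofReal r := by
    refine le_trans (le_of_eq (lintegral_congr fun x => ?_)) h
    rw [ENNReal.ofReal_pow (norm_nonneg _), ofReal_norm]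
  calc (∫⁻ x in S, ENNReal.ofReal (‖F x‖ ^ 2)).toReal ≤ (ENNReal.ofReal r).toReal :=
        ENNReal.toReal_mono ENNReal.ofReal_ne_top h'
    _ ≤ R := by rw [ENNReal.toReal_ofReal']; exact max_le hrR hR

/-- **Output conversion**: for a divergence-free `C²` slice `w` with `w ∈ L²` and `∫|curl w|²`
integrable, `∫|curl w|² ≤ R` gives `∫⁻ |∇w|²_F ≤ ofReal R`
(`lintegral_frobeniusNormSq_fderiv_le_lintegral_sq_norm_curl`). [folklore] -/
theorem lintegral_frobeniusNormSq_le_of_integral_curl_sq_le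
    {w : (EuclideanSpace ℝ (Fin 3)) → (EuclideanSpace ℝ (Fin 3))} (hw : ContDiff ℝ 2 w)
    (hdiv : VectorCalculus.IsDivFree w) (hE : Integrable fun x => ‖w x‖ ^ 2)
    (hY : Integrable fun x => ‖curl w x‖ ^ 2) {R : ℝ} (hR : ∫ x, ‖curl w x‖ ^ 2 ≤ R) :
    (∫⁻ x, ENNReal.ofReal (frobeniusNormSq (fderiv ℝ w x))) ≤ ENNReal.ofReal R := by
  refine (lintegral_frobeniusNormSq_fderiv_le_lintegral_sq_norm_curl hw hdiv
    (lintegral_enorm_sq_lt_top_of_integrable_sq hE)).trans ?_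
  rw [show (∫⁻ x, ‖curl w x‖ₑ ^ 2) = ∫⁻ x, ENNReal.ofReal (‖curl w x‖ ^ 2) from
    lintegral_congr fun x => by rw [← ofReal_norm, ENNReal.ofReal_pow (norm_nonneg _)],
    ← ofReal_integral_eq_lintegral_ofReal hY (Eventually.of_forall fun x => sq_nonneg _)]
  exact ENNReal.ofReal_le_ofReal hR

end Summit.NavierStokesRegularity.NavierStokesRegularity.Theorems.IntenseSetDoors

end
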